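import Literature.MathematicalPhysics.QuantumFieldTheory.Balaban1983to89.Node00.Record13Carriers
import Literature.MathematicalPhysics.QuantumFieldTheory.Balaban1983to89.Node00.Record12CarriersB8SubB

/-!
# NODE 00 (YM-PLAN Track A) — THE CARRIER-PINNED STAGE-13 RECORDS, [B8″]: the four-law [B8] pin `Stage13Params.pinB8SubB` over `withB8OfRecordSubB`
# (`Node00/CarriersB8SubB`) lifted to def-T's `Stage13Params` through dag-n10-d's generic `Stage13Params.rebindX` (`Node00/Record13Carriers`), its `rfl` transports, the
# `b8` leaf of the S-∕C-binding over the ONE-pin [B8″] Stage-13 view BY `Iff.rfl`, and the one-pin S-bound record `IsRecordOfRecord₁₃CSB8subB` (SAME-datum companion in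
# `IsRecordOfRecord₁₃C`; faces; slot form; rebind) — the ₁₃ twin of `Node00/Record12CarriersB8SubB` (sequel of both; nothing edited in place)

NODE 00 RECORD MODULE (seat `pub-ymgap-dag-n05-d` g4, 2026-08-27; dag-lead WORDS-130 (c) «n05-d = consumer of (A) `Record13Carriers` by name: B8Sub ₁₃ twins»).  APPEND-ONLY: a
NEW importing module; everything it reads is CONSUMED BY NAME (`Stage13Params.rebindX` ∕ `toStage5₁₃_rebindX` ∕ `Provisos₁₃.rebindX` ∕ `datumOfRecord₁₃_rebindX` of dag-n10-d's
`Node00/Record13Carriers`; def-T's `IsRecordOfRecord₁₃C` ∕ `exists_world_isRecordOfRecord₁₃C` ∕ `atWorld_of_isRecordOfRecord₁₃C` of `Node00/Record13` v1.1; this seat's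
`withB8OfRecordSubB` ∕ `B8LeafOfRecordSubB` ∕ `C136_C162_famB8OfRecordSubB` ∕ `Stage12Params.pinB8SubB`).  WHY ONE PIN AND NO VIEW: N05's ∃-currency face at a record reads only the
[B8] group; the four-pin ₁₃ view carries `WOfRecord₁₃` (the [IV] bundle along the ₁₃ plugs) which N05 does not read — so the honest ₁₃ home of N05 is the world bound by the
S-binding over `(θ.pinB8SubB lam).toStage5₁₃` (every other leaf = the C-binding's over the UNPINNED Stage-13 view, `upOfRecord₅CS_toStage5₁₃_pinB8SubB_offB8`), with its
SAME-DATUM companion in `IsRecordOfRecord₁₃C` at the C-binding of the same pinned parameters.  ref-C g18 READ116 ∕ ref-E flag (f) carry over VERBATIM: the [B8] layer is DATA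
WITHOUT LAW, the datum does not read it (`datumOfRecord₁₃_pinB8SubB : rfl`), the ∀-form is false-or-vacuous; N05 is booked only in ∃-currency at a NAMED layer
(`…_rebind_of_isRecordOfRecord₁₃C` + a closer of `B8LeafOfRecordSubB` there — `Thm/BalabanUVNodesN05AtRecord13SubB`).
[Balaban1985RegularSpaces] = Commun. Math. Phys. **99** (1985) 75–102; [Balaban1989LargeFieldII] = Commun. Math. Phys. **122** (1989) 355–392; [Balaban1988Convergent] = Commun.
Math. Phys. **119** (1988) 243–285.

WHAT IS DEFINED ∕ PROVED (kernel bookkeeping, 0 sorry).  §1 `Stage13Params.pinB8SubB` + `_toStage12Params` (rfl: = the ₁₂ pin lifted) ∕ `_res_X` ∕ `_toStage3Params` ∕ `_admissible_iff` ∕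
`toStage5₁₃_pinB8SubB` ∕ `Provisos₁₃.pinB8SubB` ∕ `datumOfRecord₁₃_pinB8SubB` (UP-SIDE); the leaves `upOfRecord₅CS_toStage5₁₃_pinB8SubB_b8_iff` (`b8 ↔ B8LeafOfRecordSubB`, Iff.rfl),
`upOfRecord₅C_toStage5₁₃_pinB8SubB_b8_iff` (typed), `upOfRecord₅CS_toStage5₁₃_pinB8SubB_offB8` (rfl ×5).  §2 **`IsRecordOfRecord₁₃CSB8subB`**, `exists_world_…` (world displayed),
**`companion_of_…`** (same D∕C∕γ∕L in `₁₃C`, witness `θ.pinB8SubB lam`; typed ⇒ surviving), `leaf_b8_iff_of_…`, `b4_b5_b6_b7_of_…` (def-T's transfer at the companion),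
`b8_b11_b10_main_iff_of_…`, `b8_main_of_…_of_slot`, `…_rebind_of_isRecordOfRecord₁₃C`.
HONEST FRAMING: definitions + kernel bookkeeping; NO estimate; nothing of Bałaban's asserted; N05 NOT discharged; counts unmoved (5∕28); one finite T⁴ programme at fixed ε — NOT
continuum ∕ ℝ⁴ ∕ infinite volume ∕ OS ∕ mass gap ∕ Clay.  No `sorry`, no `axiom`, no `opaque`, no `instance`, no `notation`. -/

noncomputable section

namespace Literature.MathematicalPhysics.QuantumFieldTheory.Balaban1983to89.Node00

open T4Continuum AveragingRT T4FiniteEpsInhabited FlowStep FlowStepRuns DagBinding T4DatumAssembly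
open B8LeafKnitRS (B8LeafRS)
open B8IdxB8LawsB (IdxB8SubB famB8OfRecordSubB)
open scoped Matrix.Norms.L2Operator

/-! ## §1. The [B8″] pin at Stage 13 (one-liners over `rebindX`) -/

section PinB8SubB13

variable (F : T4Family) (N : ℕ) [NeZero N]

/-- **The [B8″] pin of Stage-13 parameters**. [cite: Balaban1985RegularSpaces, Thm 2 p.83 (objects of record, Stage 3′(X.B8″))] -/
def Stage13Params.pinB8SubB (θ : Stage13Params F N) (lam : ResidB8 θ.toStage3Params) : Stage13Params F N :=
  θ.rebindX F N fun P => (θ.res.X P).withB8OfRecordSubB θ.toStage3Params lam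

/-- The Stage-13 [B8″] pin IS the Stage-12 one underneath (`rfl`). [cite: Balaban1985RegularSpaces, Thm 2 p.83 (bookkeeping)] -/
theorem Stage13Params.pinB8SubB_toStage12Params (θ : Stage13Params F N) (lam : ResidB8 θ.toStage3Params) :
    (θ.pinB8SubB F N lam).toStage12Params = θ.toStage12Params.pinB8SubB F N lam := rfl

/-- The [B8″]-pinned carrier family at Stage 13, unfolded (`rfl`). [cite: Balaban1985RegularSpaces, Lemma 1 – Thm 8 pp.79–101 (bookkeeping)] -/
theorem Stage13Params.pinB8SubB_res_X (θ : Stage13Params F N) (lam : ResidB8 θ.toStage3Params) (P : B12.RunParams) :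
    (θ.pinB8SubB F N lam).res.X P = (θ.res.X P).withB8OfRecordSubB θ.toStage3Params lam := rfl

/-- The [B8″] pin keeps the Stage-3 dictionary (`rfl`). [cite: Balaban1985RegularSpaces, p.77 (bookkeeping)] -/
theorem Stage13Params.pinB8SubB_toStage3Params (θ : Stage13Params F N) (lam : ResidB8 θ.toStage3Params) :
    (θ.pinB8SubB F N lam).toStage3Params = θ.toStage3Params := rfl

/-- Admissibility is unchanged by the [B8″] pin at Stage 13 (`Iff.rfl`). [cite: Balaban1987RG1, (2.9) p.266 (bookkeeping)] -/
theorem Stage13Params.pinB8SubB_admissible_iff (θ : Stage13Params F N) (lam : ResidB8 θ.toStage3Params) :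
    (θ.pinB8SubB F N lam).Admissible F N ↔ θ.Admissible F N := Iff.rfl

/-- The Stage-13 view of [B8″]-pinned parameters IS the re-bound Stage-13 view (`rfl`). [cite: Balaban1988Convergent, p.244 (bookkeeping)] -/
theorem Stage13Params.toStage5₁₃_pinB8SubB (θ : Stage13Params F N) (lam : ResidB8 θ.toStage3Params) :
    (θ.pinB8SubB F N lam).toStage5₁₃ F N = (θ.toStage5₁₃ F N).rebindX F N (fun P => (θ.res.X P).withB8OfRecordSubB θ.toStage3Params lam) :=
  Stage13Params.toStage5₁₃_rebindX F N θ _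

variable {F N} in
/-- The Stage-13 provisos transport along the [B8″] pin. [cite: Balaban1988Convergent, (2.23)–(2.42) pp.259–262 (bookkeeping)] -/
theorem Stage13Params.Provisos₁₃.pinB8SubB {θ : Stage13Params F N} (h : θ.Provisos₁₃ F N) (lam : ResidB8 θ.toStage3Params) : (θ.pinB8SubB F N lam).Provisos₁₃ F N :=
  h.rebindX _

/-- UP-SIDE: the Stage-13 datum of record is unchanged by the [B8″] pin (`rfl`). [cite: Balaban1989LargeFieldII, Thm 1 + (0.1) pp.355–356 (bookkeeping)] -/
theorem datumOfRecord₁₃_pinB8SubB (θ : Stage13Params F N) (h : θ.Provisos₁₃ F N) (lam : ResidB8 θ.toStage3Params) :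
    datumOfRecord₁₃ F N (θ.pinB8SubB F N lam) (h.pinB8SubB lam) = datumOfRecord₁₃ F N θ h :=
  datumOfRecord₁₃_rebindX F N θ h _ (h.pinB8SubB lam)

/-- **THE `b8` LEAF OF THE S-BINDING OVER THE [B8″]-PINNED STAGE-13 VIEW IS `B8LeafOfRecordSubB`** (`Iff.rfl` through `toStage5₁₃_rebindX` and `carriers₃_withB8OfRecordSubB`).
[cite: Balaban1985RegularSpaces, Lemma 1 – Thm 8 pp.79–101 (the leaf at the objects of record)] -/
theorem upOfRecord₅CS_toStage5₁₃_pinB8SubB_b8_iff (θ : Stage13Params F N) (lam : ResidB8 θ.toStage3Params) (P : B12.RunParams) :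
    (upOfRecord₅CS F N ((θ.pinB8SubB F N lam).toStage5₁₃ F N) P).b8 ↔ B8LeafOfRecordSubB θ.toStage3Params lam :=
  Iff.rfl

/-- … and the C-binding's `b8` over it is the leaf AS TYPED at the re-keyed group (`Iff.rfl`). [cite: Balaban1985RegularSpaces, Lemma 1 – Thm 8 pp.79–101 (bookkeeping)] -/
theorem upOfRecord₅C_toStage5₁₃_pinB8SubB_b8_iff (θ : Stage13Params F N) (lam : ResidB8 θ.toStage3Params) (P : B12.RunParams) :
    (upOfRecord₅C F N ((θ.pinB8SubB F N lam).toStage5₁₃ F N) P).b8 ↔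
      B8LeafR θ.D (θ.L : ℝ) lam.C₂ lam.B₁' lam.inp.B₀' lam.B₁ lam.B₂ lam.c₁ lam.inp lam.B₀β (B8Lemma1NonAbelian.blockPairNA θ.D θ.L θ.𝔸)
        (fun j : IdxB8SubB θ.toStage3Params => famB8OfRecordSubB θ.toStage3Params lam.β lam.len j) lam.lan lam.cub (fun j => lam.toAxial j.1) :=
  Iff.rfl

/-- The other leaves of the S-binding over the [B8″]-pinned Stage-13 view are the C-binding's over the UNPINNED Stage-13 view (`rfl` ×5: the pin moves only the [B8] group,
the S-binding re-binds only `b8`). [cite: Balaban1989LargeFieldII, Thm 1 p.355 (bookkeeping)] -/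
theorem upOfRecord₅CS_toStage5₁₃_pinB8SubB_offB8 (θ : Stage13Params F N) (lam : ResidB8 θ.toStage3Params) (P : B12.RunParams) :
    (upOfRecord₅CS F N ((θ.pinB8SubB F N lam).toStage5₁₃ F N) P).b9 = (upOfRecord₅C F N (θ.toStage5₁₃ F N) P).b9 ∧
    (upOfRecord₅CS F N ((θ.pinB8SubB F N lam).toStage5₁₃ F N) P).b10 = (upOfRecord₅C F N (θ.toStage5₁₃ F N) P).b10 ∧
    (upOfRecord₅CS F N ((θ.pinB8SubB F N lam).toStage5₁₃ F N) P).b11 = (upOfRecord₅C F N (θ.toStage5₁₃ F N) P).b11 ∧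
    (upOfRecord₅CS F N ((θ.pinB8SubB F N lam).toStage5₁₃ F N) P).b12 = (upOfRecord₅C F N (θ.toStage5₁₃ F N) P).b12 ∧
    (upOfRecord₅CS F N ((θ.pinB8SubB F N lam).toStage5₁₃ F N) P).rBasicStep = (upOfRecord₅C F N (θ.toStage5₁₃ F N) P).rBasicStep :=
  ⟨rfl, rfl, rfl, rfl, rfl⟩

end PinB8SubB13

/-! ## §2. The ONE-pin S-bound Stage-13 record with [B8″]; companion in `₁₃C`; faces; rebind -/

section Record13B8subB

variable (F : T4Family) (N : ℕ) [NeZero N]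

/-- **«(D, w) is the record, Stage 13, [B8] group pinned over the four-law sub-index, `b8` surviving»**: def-T's `IsRecordOfRecord₁₃C` VERBATIM except that the world is
bound by the S-binding over the [B8″]-PINNED Stage-13 view, for SOME residual [B8] layer `lam` (data quantified with the record's parameters).
[cite: Balaban1985RegularSpaces, Lemma 1 – Thm 8 pp.79–101, (1.12) p.78; Balaban1989LargeFieldII, Thm 1 + (0.1) pp.355–356 (objects of record)] -/
def IsRecordOfRecord₁₃CSB8subB (D : FiniteEpsData F (SU N)) (w : WorldP) : Prop :=
  ∃ (θ : Stage13Params F N) (h : θ.Provisos₁₃ F N) (lam : ResidB8 θ.toStage3Params),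
    θ.Admissible F N ∧ D = datumOfRecord₁₃ F N θ h ∧ w.C = D.C ∧ (0 < w.γ ∧ w.γ ≤ θ.γ) ∧ w.L = (θ.L : ℝ) ∧
      ∀ P : B12.RunParams, w.up P = upOfRecord₅CS F N ((θ.pinB8SubB F N lam).toStage5₁₃ F N) P

/-- Inhabitation is Stage 13's exactly (the residual [B8] type is inhabited, `nonempty_residB8`). [cite: Balaban1989LargeFieldII, Thm 1 + (0.1) pp.355–356 (bookkeeping)] -/
theorem exists_world_isRecordOfRecord₁₃CSB8subB (θ : Stage13Params F N) (h : θ.Provisos₁₃ F N) (hθ : θ.Admissible F N) (lam : ResidB8 θ.toStage3Params) {γw : ℝ}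
    (hγw : 0 < γw ∧ γw ≤ θ.γ) :
    ∃ w : WorldP, IsRecordOfRecord₁₃CSB8subB F N (datumOfRecord₁₃ F N θ h) w ∧ w.γ = γw ∧
      ∀ P : B12.RunParams, w.up P = upOfRecord₅CS F N ((θ.pinB8SubB F N lam).toStage5₁₃ F N) P := by
  obtain ⟨w₀, -, -⟩ := exists_world_isRecordOfRecord₁₃C F N θ h hθ hγw
  exact ⟨{ w₀ with
      C := (datumOfRecord₁₃ F N θ h).C, γ := γw, L := (θ.L : ℝ), one_lt_L := by exact_mod_cast θ.hL.2,
      up := fun P => upOfRecord₅CS F N ((θ.pinB8SubB F N lam).toStage5₁₃ F N) P },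
    ⟨θ, h, lam, hθ, rfl, rfl, hγw, rfl, fun _ => rfl⟩, rfl, fun _ => rfl⟩

variable {F N}
variable {D : FiniteEpsData F (SU N)} {w : WorldP}

/-- **THE SAME-DATUM COMPANION IN `IsRecordOfRecord₁₃C`** (witness `θ.pinB8SubB lam` under the C-binding): same `D`, `C`, window, `L`; leaves agree off `b8`; companion's `b8`
(typed, over the four-law sub-family) ⇒ record's `b8` (surviving) under the carrier law (1.36) ⊂ (1.62) — never conversely.
[cite: Balaban1985RegularSpaces, Thm 8 p.101 (surviving vs typed); Balaban1989LargeFieldII, Thm 1 + (0.1) pp.355–356 (bookkeeping)] -/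
theorem companion_of_isRecordOfRecord₁₃CSB8subB (h : IsRecordOfRecord₁₃CSB8subB F N D w) :
    ∃ w' : WorldP, IsRecordOfRecord₁₃C F N D w' ∧ w'.C = w.C ∧ w'.γ = w.γ ∧ w'.L = w.L ∧
      (∀ P : B12.RunParams, leavesP w P = { leavesP w' P with b8 := (leavesP w P).b8 }) ∧
      ∀ P : B12.RunParams, (leavesP w' P).b8 → (leavesP w P).b8 := by
  obtain ⟨θ, hP, lam, hθ, hD, hC, hγ, hL, hup⟩ := h
  have hup' : ∀ P, w.up P = (upOfRecord₅C F N ((θ.pinB8SubB F N lam).toStage5₁₃ F N) P).withB8 (leavesP w P).b8 := fun P => by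
    show w.up P = (upOfRecord₅C F N _ P).withB8 (w.up P).b8
    rw [hup P]
    rfl
  refine ⟨{ w with up := fun P => upOfRecord₅C F N ((θ.pinB8SubB F N lam).toStage5₁₃ F N) P },
    ⟨θ.pinB8SubB F N lam, hP.pinB8SubB lam, (Stage13Params.pinB8SubB_admissible_iff F N _ _).2 hθ, ?_, hC, hγ, hL, fun P => rfl⟩, rfl, rfl, rfl,
      leavesP_eq_of_up_withB8 hup', fun P h8 => ?_⟩
  · rw [datumOfRecord₁₃_pinB8SubB F N θ hP lam]; exact hD
  · have h8' := (upOfRecord₅C_toStage5₁₃_pinB8SubB_b8_iff F N θ lam P).1 h8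
    show (w.up P).b8
    rw [hup P]
    exact (upOfRecord₅CS_toStage5₁₃_pinB8SubB_b8_iff F N θ lam P).2
      (B8LeafKnitRS.b8LeafRS_of_b8LeafR (C136_C162_famB8OfRecordSubB lam.β lam.len) h8')

/-- The `b8` leaf at a record of this module, for ONE parameter package. [cite: Balaban1985RegularSpaces, Lemma 1 – Thm 8 pp.79–101 (bookkeeping)] -/
theorem leaf_b8_iff_of_isRecordOfRecord₁₃CSB8subB (h : IsRecordOfRecord₁₃CSB8subB F N D w) :
    ∃ (θ : Stage13Params F N) (lam : ResidB8 θ.toStage3Params), θ.Admissible F N ∧ w.L = (θ.L : ℝ) ∧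
      ∀ P : B12.RunParams, (leavesP w P).b8 ↔ B8LeafOfRecordSubB θ.toStage3Params lam := by
  obtain ⟨θ, -, lam, hθ, -, -, -, hL, hup⟩ := h
  refine ⟨θ, lam, hθ, hL, fun P => ?_⟩
  show (w.up P).b8 ↔ _
  rw [hup P]
  exact upOfRecord₅CS_toStage5₁₃_pinB8SubB_b8_iff F N θ lam P

/-- The in-edges `b4 b5 b6 b7` are THEOREMS at a record of this module (via the companion and def-T's transfer). [cite: Balaban1983RegularityDecay, Thm p.573; Balaban1984PropagatorsI, Props. 1.1–1.2 pp.33–36; Balaban1984PropagatorsII, pp.223–250; Balaban1985Averaging, Props. 1–10 pp.26–50 (bookkeeping)] -/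
theorem b4_b5_b6_b7_of_isRecordOfRecord₁₃CSB8subB (h : IsRecordOfRecord₁₃CSB8subB F N D w) (P : B12.RunParams) :
    (leavesP w P).b4 ∧ (leavesP w P).b5 ∧ (leavesP w P).b6 ∧ (leavesP w P).b7 := by
  obtain ⟨w', hw', -, -, -, hleaves, -⟩ := companion_of_isRecordOfRecord₁₃CSB8subB h
  have h' : (leavesP w' P).b4 ∧ (leavesP w' P).b5 ∧ (leavesP w' P).b6 ∧ (leavesP w' P).b7 :=
    atWorld_of_isRecordOfRecord₁₃C (X := fun ℓ => ℓ.b4 ∧ ℓ.b5 ∧ ℓ.b6 ∧ ℓ.b7)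
      (fun _ _ h5 P =>
        have h4 := b4_main_of_isRecordOfRecord₅C h5 P
        have hb5 := b5_main_of_isRecordOfRecord₅C h5 P h4
        ⟨h4, hb5, N03_at_record₅C h5 P h4 hb5, b7_main_of_isRecordOfRecord₅C h5 P hb5⟩) hw' P
  rw [hleaves P]
  exact h'

/-- **N05 ∕ N07 ∕ N08 AT A RECORD OF THIS MODULE** (in-edges b4–b7 are theorems). [cite: Balaban1985RegularSpaces, Thm 2 p.83, Thm 8 p.101; Balaban1985Variational, Thm 1 p.279; Balaban1985UV3, Thm 1 p.257 (bookkeeping)] -/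
theorem b8_b11_b10_main_iff_of_isRecordOfRecord₁₃CSB8subB (h : IsRecordOfRecord₁₃CSB8subB F N D w) (P : B12.RunParams) :
    (Dag.B8_main (leavesP w P) ↔ ((leavesP w P).b9 → (leavesP w P).b8)) ∧
    (Dag.B11_main (leavesP w P) ↔ ((leavesP w P).b8 → (leavesP w P).b9 → (leavesP w P).b11)) ∧
    (Dag.B10_main (leavesP w P) ↔ ((leavesP w P).b8 → (leavesP w P).b9 → (leavesP w P).b11 → (leavesP w P).b10)) := by
  obtain ⟨-, h5, h6, h7⟩ := b4_b5_b6_b7_of_isRecordOfRecord₁₃CSB8subB h P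
  exact ⟨⟨fun hN h9 => hN h5 h6 h7 h9, fun hN _ _ _ => hN⟩, ⟨fun hN h8 h9 => hN h5 h6 h7 h8 h9, fun hN _ _ _ => hN⟩,
    ⟨fun hN h8 h9 h11 => hN h5 h6 h7 h8 h9 h11, fun hN _ _ _ => hN⟩⟩

/-- **N05 «SLOT» FORM at a record of this module**: a closer of `B8LeafOfRecordSubB` at every presenting package gives `Dag.B8_main` at every run.
[cite: Balaban1985RegularSpaces, Lemma 1 – Thm 8 pp.79–101 (the node's shape, bookkeeping)] -/
theorem b8_main_of_isRecordOfRecord₁₃CSB8subB_of_slot (h : IsRecordOfRecord₁₃CSB8subB F N D w)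
    (hB : ∀ (θ : Stage13Params F N) (hP : θ.Provisos₁₃ F N) (lam : ResidB8 θ.toStage3Params), θ.Admissible F N → D = datumOfRecord₁₃ F N θ hP →
      (∀ P, w.up P = upOfRecord₅CS F N ((θ.pinB8SubB F N lam).toStage5₁₃ F N) P) → B8LeafOfRecordSubB θ.toStage3Params lam)
    (P : B12.RunParams) : Dag.B8_main (leavesP w P) := by
  obtain ⟨h8iff, -, -⟩ := b8_b11_b10_main_iff_of_isRecordOfRecord₁₃CSB8subB h P
  obtain ⟨θ, hP, lam, hθ, hD, -, -, -, hup⟩ := h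
  refine h8iff.2 fun _ => ?_
  show (w.up P).b8
  rw [hup P]
  exact (upOfRecord₅CS_toStage5₁₃_pinB8SubB_b8_iff F N θ lam P).2 (hB θ hP lam hθ hD hup)

/-- RE-BINDING a `₁₃C` record's world by the S-binding over the [B8″]-pinned view gives a record of this module with the SAME datum — the ∃-currency entry point (the [B8]
layer `lam`, e.g. the cut layer `λ.cutSubB J lan c₁`, is CHOSEN here). [cite: Balaban1989LargeFieldII, Thm 1 p.355 (bookkeeping)] -/
theorem isRecordOfRecord₁₃CSB8subB_rebind_of_isRecordOfRecord₁₃C (h : IsRecordOfRecord₁₃C F N D w) :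
    ∃ (θ : Stage13Params F N) (_ : θ.Provisos₁₃ F N), θ.Admissible F N ∧ (∀ P, w.up P = upOfRecord₅C F N (θ.toStage5₁₃ F N) P) ∧
      ∀ lam : ResidB8 θ.toStage3Params,
        IsRecordOfRecord₁₃CSB8subB F N D { w with up := fun P => upOfRecord₅CS F N ((θ.pinB8SubB F N lam).toStage5₁₃ F N) P } := by
  obtain ⟨θ, hP, hθ, hD, hC, hγ, hL, hup⟩ := h
  exact ⟨θ, hP, hθ, hup, fun lam => ⟨θ, hP, lam, hθ, hD, hC, hγ, hL, fun _ => rfl⟩⟩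

end Record13B8subB

end Literature.MathematicalPhysics.QuantumFieldTheory.Balaban1983to89.Node00

end
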